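import Summits.QuantumFields.YangMills.Theorems.BalabanUVNodesN18CombStepNearIdentity
import Summits.QuantumFields.YangMills.Theorems.BalabanUVNodesN18AvgRemainderCoarseDiff
import Literature.MathematicalPhysics.QuantumFieldTheory.Balaban1983to89.T4Covariance
import HarnessLib

/-!
# BalabanUVNodes ∕ node N18 = NE5 — closure-ledger item (iii), comb step M4c, file (6a):
# THE UNGUARDED (0.4) AVERAGE ON UNITS-VALUED FIELDS IS TRANSLATION-COVARIANT, AND SO IS THE LINEARISATION REMAINDER OF THE AVERAGED POTENTIAL

(Track A, DAG node N18 = `T4OutputRate.NE5`; cluster K4 «SpineRates», key item K3⁸ `SpineGivenEndpointR13SepCoPHV` (stmt-QuantumFields-27366);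
seat pub-ymgap-dag-n18-w3 g5, INTENT-6 = design step M4c of `COMB-STEP-DESIGN.md` ∕ `COMB-CHAIN-INDEX.md`.)

HONEST FRAMING.  Count-neutral kernel bookkeeping (`--supports stmt-QuantumFields-27366 --as helper`): the (2.17) translation covariance of the
(0.4) average, `Ū(U ∘ τ_{La})(c) = Ū(U)(c + a)`, in the tree's letters for the UNGUARDED average `W1.avgUnits = Prop8Chart.emlAvgU` on
`𝔸ˣ`-valued configurations (the tree has it for the guarded `avgFun ℰ` on group-valued fields: `BlockAveraging.avgFun_translate`; and for `Q₁`: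
dag-n18-d's `linAvg_translate`), plus the consequence the coarse-Lipschitz bound of M4c (files (6b), (6c)) rests on: the linearisation remainder
`(iξ)⁻¹log(Ū(S)(c)Ū(U₀)(c)⁻¹) − (η∕ξ)(Q₁A)(c)` evaluated at the NEXT coarse bond `c + a` is the same functional of the translated fields at `c`.
Nothing of Bałaban's analysis is asserted; NE5 NOT printed ∕ NOT proved; N18 NOT discharged; finite tori — nothing about the continuum ∕ OS ∕ mass gap;
YM mass gap (Clay) NOT proved — R4 closes the conditional finite-𝕋⁴ rung `BalabanLadder.UV` only.

WHAT.
* `holT_translate` — `(τ_a V)(Γ from x) = V(Γ from x + a)` for configurations with values in any group ((9) bookkeeping).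
* `loopVarU_translate`, `straightU_translate` — the (0.4) loop variables ∕ straight transporter of `U ∘ τ_{La}` at `c` are those of `U` at `c + a` (`Site.emb_add`).
* ★ `avgUnits_translate_apply`, `avgUnits_translate` — `Ū(U ∘ τ_{La}) = Ū(U) ∘ τ_a` for the unguarded units-valued average.
* ★ `potRem_translate` — the remainder functional at `c + a` equals the functional of the translated triple `(S ∘ τ_{La}, U₀ ∘ τ_{La}, A ∘ τ_{La})` at `c`.

0 `def`, 0 `sorry`.  References: T. Bałaban, CMP **109** (1987) 249–301 [Balaban1987RG1] ((0.4) p.253, (2.17) p.269); CMP **98** (1985) 17–51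
[Balaban1985Averaging] ((9) p.18, Prop. 3 (122)–(125) p.36).
-/

noncomputable section

open scoped BigOperators Matrix.Norms.L2Operator
open NormedSpace

namespace YMDAG.N18.TransportOfRecord

open Complex (I)
open Literature.MathematicalPhysics.QuantumFieldTheory.Balaban1983to89
open Literature.MathematicalPhysics.QuantumFieldTheory.Balaban1983to89.T4Continuum
open Literature.MathematicalPhysics.QuantumFieldTheory.Balaban1983to89.BlockAveraging
open Literature.MathematicalPhysics.QuantumFieldTheory.Balaban1983to89.BlockAveragingEMLLinearised (linAvg)
open Literature.MathematicalPhysics.QuantumFieldTheory.Balaban1983to89.B10Eq27TorusAxialLog (holT holT_nil holT_cons_true holT_cons_false)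
open Literature.MathematicalPhysics.QuantumFieldTheory.Balaban1983to89.MatrixLog (mlog)
open Literature.MathematicalPhysics.QuantumFieldTheory.Balaban1983to89.Node00.W1 (avgUnits loopVarU straightU val_avgUnits)
open YMDAG.N18.HolonomyLipschitz (linAvg_translate)

/-! ## §1 Transports of a translated configuration -/

section Transport

variable {P : Params} {j : ℕ} {G : Type*} [Group G]

/-- **Transports of the translate are translated transports**: `(τ_a V)(Γ from x) = V(Γ from x + a)` (`(τ_a V)(b) = V(b + a)`, `(x + a) ± e_μ = (x ± e_μ) + a`).
(bookkeeping of the parallel transport (9), no content of the series) [cite: Balaban1985Averaging, (9) p.18; Balaban1987RG1, (2.17) p.269] -/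
theorem holT_translate (V : GaugeField P j G) (a : Site P j) : ∀ (x : Site P j) (w : List (B7Prop1Explicit.Letter P.d)),
    holT (V.translate a) x w = holT V (x + a) w
  | x, [] => by rw [holT_nil, holT_nil]
  | x, (μ, true) :: w => by
    rw [holT_cons_true, holT_cons_true, holT_translate V a (x.shift μ) w, GaugeField.translate_apply, Site.shift_add]
    rfl
  | x, (μ, false) :: w => by
    rw [holT_cons_false, holT_cons_false, holT_translate V a (x.unshift μ) w, GaugeField.translate_apply, Site.unshift_add]
    rfl

end Transport

/-! ## §2 The unguarded (0.4) average on units-valued fields is translation-covariant -/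

section Average

variable {P : Params} {j : ℕ} {𝔸 : Type*} [NormedRing 𝔸] [NormedAlgebra ℂ 𝔸] [CompleteSpace 𝔸]

omit [NormedAlgebra ℂ 𝔸] [CompleteSpace 𝔸] in
/-- The (0.4) loop variables of `U ∘ τ_{La}` at `c` are those of `U` at `c + a` (`emb(c₋ + a) = emb c₋ + La`). [cite: Balaban1987RG1, (0.4) p.253, (2.17) p.269] -/
theorem loopVarU_translate (a : Site P (j + 1)) (U : GaugeField P j 𝔸ˣ) (c : PBond P (j + 1)) (i : Idx P) :
    loopVarU (U.translate (Site.scale a)) c i = loopVarU U (c.translate a) i := by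
  unfold loopVarU
  rw [holT_translate, PBond.translate_src, PBond.translate_dir, Site.emb_add]

omit [NormedAlgebra ℂ 𝔸] [CompleteSpace 𝔸] in
/-- The straight transporter of `U ∘ τ_{La}` at `c` is that of `U` at `c + a`. [cite: Balaban1987RG1, (0.4) p.253, (2.17) p.269] -/
theorem straightU_translate (a : Site P (j + 1)) (U : GaugeField P j 𝔸ˣ) (c : PBond P (j + 1)) :
    straightU (U.translate (Site.scale a)) c = straightU U (c.translate a) := by
  unfold straightU
  rw [holT_translate, PBond.translate_src, PBond.translate_dir, Site.emb_add]

/-- ★ **THE UNGUARDED (0.4) AVERAGE INTERTWINES THE TRANSLATIONS**, pointwise: `Ū(U ∘ τ_{La})(c) = Ū(U)(c + a)`.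
[cite: Balaban1987RG1, (0.4) p.253, (2.17) p.269] -/
theorem avgUnits_translate_apply (a : Site P (j + 1)) (U : GaugeField P j 𝔸ˣ) (c : PBond P (j + 1)) :
    avgUnits (U.translate (Site.scale a)) c = avgUnits U (c.translate a) := by
  apply Units.ext
  rw [val_avgUnits, val_avgUnits, straightU_translate]
  congr 2
  funext i
  rw [loopVarU_translate]

/-- ★ `Ū(U ∘ τ_{La}) = Ū(U) ∘ τ_a` (the units-carrier twin of `BlockAveraging.avgFun_translate`). [cite: Balaban1987RG1, (0.4) p.253, (2.17) p.269] -/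
theorem avgUnits_translate (a : Site P (j + 1)) (U : GaugeField P j 𝔸ˣ) :
    avgUnits (U.translate (Site.scale a)) = (avgUnits U).translate a := by
  funext c
  rw [avgUnits_translate_apply, GaugeField.translate_apply]

end Average

/-! ## §3 The linearisation remainder of the averaged potential is translation-covariant -/

section Remainder

variable {P : Params} {j : ℕ} {n : Type*} [Fintype n] [DecidableEq n]

/-- ★ **THE REMAINDER FUNCTIONAL AT THE NEXT COARSE BOND IS THE FUNCTIONAL OF THE TRANSLATED FIELDS**: with
`F_c[S, U₀, A] = (iξ)⁻¹log(Ū(S)(c)Ū(U₀)(c)⁻¹) − (η∕ξ)(Q₁A)(c)`, `F_{c+a}[S, U₀, A] = F_c[S ∘ τ_{La}, U₀ ∘ τ_{La}, A ∘ τ_{La}]`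
(`avgUnits_translate_apply`, dag-n18-d's `linAvg_translate`). [cite: Balaban1987RG1, (0.4) p.253, (2.17) p.269; Balaban1985Averaging, Prop. 3 (122)-(125) p.36] -/
theorem potRem_translate (a : Site P (j + 1)) (S U₀ : GaugeField P j (Matrix n n ℂ)ˣ) (A : PBond P j → Matrix n n ℂ) (η ξ : ℝ) (c : PBond P (j + 1)) :
    (I * (ξ : ℂ))⁻¹ • mlog (((avgUnits (S.translate (Site.scale a)) c : (Matrix n n ℂ)ˣ) : Matrix n n ℂ) *
          (((avgUnits (U₀.translate (Site.scale a)) c)⁻¹ : (Matrix n n ℂ)ˣ) : Matrix n n ℂ)) -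
        ((η / ξ : ℝ) : ℂ) • linAvg (fun b => A (b.translate (Site.scale a))) c =
      (I * (ξ : ℂ))⁻¹ • mlog (((avgUnits S (c.translate a) : (Matrix n n ℂ)ˣ) : Matrix n n ℂ) *
          (((avgUnits U₀ (c.translate a))⁻¹ : (Matrix n n ℂ)ˣ) : Matrix n n ℂ)) -
        ((η / ξ : ℝ) : ℂ) • linAvg A (c.translate a) := by
  rw [avgUnits_translate_apply, avgUnits_translate_apply, linAvg_translate]

/-- The translated bond `c + e_ν` of the coarse lattice is the shifted bond `⟨c₋ + e_ν, dir c⟩` (`Site.add_zero_shift`). [folklore] -/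
theorem translate_zero_shift_eq (c : PBond P (j + 1)) (ν : Fin P.d) :
    c.translate ((0 : Site P (j + 1)).shift ν) = ⟨c.src.shift ν, c.dir⟩ := by
  cases c
  simp only [PBond.translate, Site.add_zero_shift]

end Remainder

end YMDAG.N18.TransportOfRecord

end
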